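import Literature.AlgebraicTopology.SingularHomology.TwoPieceProductCohomology
import Literature.AlgebraicTopology.SingularHomology.CohomologyDisjointOpenCover
import HarnessLib

/-!
# `Hⁱ⁺¹(U × C) ≅ Hⁱ⁺¹(U) ⊕ Hⁱ(U)` for a circle-like space `C`

A. Hatcher, *Algebraic Topology* (2002), §3.1 pp. 199–202 (long exact sequence of a pair, excision,
homotopy invariance, additivity), in the form of the classical computation
"`H^*(U × S¹) ≅ H^*(U) ⊗ H^*(S¹)`" WITHOUT products: call a space `C` **circle-like** (w.r.t. the
data `Y₁, Y₂, Z₊, Z₋ ⊆ C`, `IsCircleLike`) if `C = Y₁ ∪ Y₂` with `Y₁`, `Y₂` open and contractible and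
`Y₁ ∩ Y₂ = Z₊ ⊔ Z₋` with `Z₊`, `Z₋` open, disjoint and contractible — e.g. `S¹` (two arcs), or
`ℂ^× = (ℂ ∖ ℝ≤0) ∪ (ℂ ∖ ℝ≥0)` with `Z± = {±im > 0}`. Then for every space `U`, every coefficient
module and every `i`, the map

  `circleMap : Hⁱ⁺¹(U) × Hⁱ(U) → Hⁱ⁺¹(U × C)`, `(y, c) ↦ pr₁^* y + κ(ext₊ c)`

is a LINEAR BIJECTION (`circleMap_bijective`), natural in `U` (`map_prodMapId_circleMap`), with
`s^* ∘ circleMap = pr₁` for every slice `s` (`map_sliceAt_circleMap`), and a class lies in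
`pr₁^* Hⁱ⁺¹(U)` iff its second coordinate vanishes (`circleMap_mem_range_iff`); in degree `0`,
`pr₁^* : H⁰(U) ≅ H⁰(U × C)` (`TwoPieceProductCohomology.map_fst_bijective_zero`). Here `κ` is the map
`Hⁱ(U × (Z₊ ⊔ Z₋)) → Hⁱ⁺¹(U × C)` of `TwoPieceProductCohomology` (coboundary, inverse excision, forget
the pair) and `ext₊ c` is the class of `U × (Z₊ ⊔ Z₋)` equal to `pr₁^* c` on `U × Z₊` and to `0` on
`U × Z₋` (additivity over the clopen partition, `CohomologyDisjointOpenCover`).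

This is the middle step of the computation of the cohomology of a trivialised `ℂP¹`-bundle
`U × ℂP¹` (`SphereLikeProductCohomology`), the local input of the first Chern class. Everything is
proved; no named facts.

## References

* A. Hatcher, *Algebraic Topology*, CUP 2002, §3.1 pp. 199–202; Example 3.?? (`H^*(X × S¹)`),
  cf. Thm. 3.16 (Künneth) of which this is the products-free special case. [HatcherAT2002]
-/

noncomputable section

open CategoryTheory Set

universe u v

namespace Literature.AlgebraicTopology.SingularHomology

variable {U U' : Type u} {Y : Type u} [TopologicalSpace U] [TopologicalSpace U'] [TopologicalSpace Y]

/-! ### Circle-like data -/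

/-- **Circle-like data on a space `Y`**: `Y = Y₁ ∪ Y₂` with `Y₁, Y₂` open and contractible, and
`Y₁ ∩ Y₂ = Z₊ ⊔ Z₋` with `Z₊, Z₋` open, disjoint and contractible (e.g. the circle covered by two
arcs; the punctured plane covered by two slit planes). [folklore] -/
structure IsCircleLike (Y : Type u) [TopologicalSpace Y] (Y₁ Y₂ Zp Zm : Set Y) : Prop where
  isOpen_left : IsOpen Y₁
  isOpen_right : IsOpen Y₂
  union_eq : Y₁ ∪ Y₂ = univ
  contractible_left : ContractibleSpace ↥Y₁
  contractible_right : ContractibleSpace ↥Y₂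
  isOpen_plus : IsOpen Zp
  isOpen_minus : IsOpen Zm
  plus_union_minus : Zp ∪ Zm = Y₁ ∩ Y₂
  disjoint : Disjoint Zp Zm
  contractible_plus : ContractibleSpace ↥Zp
  contractible_minus : ContractibleSpace ↥Zm

/-! ### The pieces `U × Z±` of `U × (Y₁ ∩ Y₂)` -/

variable (U) in
/-- `U × Zs` as a subset of the subspace `↥(U × (Y₁ ∩ Y₂))` (of `↥(U × Y₂)`). [folklore] -/
def interPiece (Y₁ Y₂ Zs : Set Y) : Set ↥(inter U Y₁ Y₂) := {p | p.1.1.2 ∈ Zs}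

/-- `U × Zs` is open in `U × (Y₁ ∩ Y₂)` for `Zs` open. [folklore] -/
theorem isOpen_interPiece {Y₁ Y₂ Zs : Set Y} (h : IsOpen Zs) : IsOpen (interPiece U Y₁ Y₂ Zs) :=
  h.preimage ((continuous_snd.comp continuous_subtype_val).comp continuous_subtype_val)

variable (U) in
/-- The projection `U × Zs → U`. [folklore] -/
def fstPiece (Y₁ Y₂ Zs : Set Y) : C(↥(interPiece U Y₁ Y₂ Zs), U) where
  toFun p := p.1.1.1.1
  continuous_toFun :=
    ((continuous_fst.comp continuous_subtype_val).comp continuous_subtype_val).comp continuous_subtype_val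

variable (U) in
/-- The slice `u ↦ (u, z)` into `U × Zs`, `z ∈ Zs ⊆ Y₁ ∩ Y₂`. [folklore] -/
def secPiece {Y₁ Y₂ Zs : Set Y} (hZs : Zs ⊆ Y₁ ∩ Y₂) {z : Y} (hz : z ∈ Zs) : C(U, ↥(interPiece U Y₁ Y₂ Zs)) where
  toFun u := ⟨⟨⟨(u, z), (hZs hz).2⟩, (hZs hz).1⟩, hz⟩
  continuous_toFun := (((continuous_id.prodMk continuous_const).subtype_mk _).subtype_mk _).subtype_mk _

variable (U) in
/-- `↥(U × Zs) ≃ₜ U × ↥Zs`. [folklore] -/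
def interPieceHomeomorph {Y₁ Y₂ Zs : Set Y} (hZs : Zs ⊆ Y₁ ∩ Y₂) : ↥(interPiece U Y₁ Y₂ Zs) ≃ₜ U × ↥Zs where
  toFun p := (p.1.1.1.1, ⟨p.1.1.1.2, p.2⟩)
  invFun q := ⟨⟨⟨(q.1, (q.2 : Y)), (hZs q.2.2).2⟩, (hZs q.2.2).1⟩, q.2.2⟩
  left_inv _ := rfl
  right_inv _ := rfl
  continuous_toFun :=
    (((continuous_fst.comp continuous_subtype_val).comp continuous_subtype_val).comp continuous_subtype_val).prodMk
      ((((continuous_snd.comp continuous_subtype_val).comp continuous_subtype_val).comp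
        continuous_subtype_val).subtype_mk _)
  continuous_invFun :=
    (((continuous_fst.prodMk (continuous_subtype_val.comp continuous_snd)).subtype_mk _).subtype_mk _).subtype_mk _

/-- `U × Zs → U` factors through `↥(U × Zs) ≃ₜ U × ↥Zs`. [folklore] -/
theorem fstPiece_eq_comp {Y₁ Y₂ Zs : Set Y} (hZs : Zs ⊆ Y₁ ∩ Y₂) :
    fstPiece U Y₁ Y₂ Zs =
      (ContinuousMap.fst : C(U × ↥Zs, U)).comp (interPieceHomeomorph U hZs : C(↥(interPiece U Y₁ Y₂ Zs), U × ↥Zs)) :=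
  rfl

/-- `pr ∘ s = 𝟙` on `U × Zs`. [folklore] -/
theorem fstPiece_comp_secPiece {Y₁ Y₂ Zs : Set Y} (hZs : Zs ⊆ Y₁ ∩ Y₂) {z : Y} (hz : z ∈ Zs) :
    (fstPiece U Y₁ Y₂ Zs).comp (secPiece U hZs hz) = ContinuousMap.id U := rfl

/-- `U × (Y₁ ∩ Y₂) → U` restricted to `U × Zs`. [folklore] -/
theorem fstInter_comp_subsetIncl_interPiece (Y₁ Y₂ Zs : Set Y) :
    (fstInter U Y₁ Y₂).comp (subsetIncl (interPiece U Y₁ Y₂ Zs)) = fstPiece U Y₁ Y₂ Zs := rfl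

variable (R : Type v) [CommRing R] (M : Type v) [AddCommGroup M] [Module R M]

section Piece

variable {Y₁ Y₂ Zs : Set Y} [ContractibleSpace ↥Zs]

/-- `(U × Zs → U)^*` is bijective for contractible `Zs`. [cite: HatcherAT2002, §3.1 p. 201] -/
theorem map_fstPiece_bijective (hZs : Zs ⊆ Y₁ ∩ Y₂) (n : ℕ) :
    Function.Bijective (singularCohomology.map R M (fstPiece U Y₁ Y₂ Zs) n) := by
  rw [fstPiece_eq_comp hZs, singularCohomology.map_comp]
  exact (singularCohomology.mapIso R M (interPieceHomeomorph U hZs) n).toLinearEquiv.bijective.comp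
    (map_fst_bijective R M n)

/-- `(U × Zs → U)^* ∘ s^* = 𝟙` on `Hⁿ(U × Zs)` for contractible `Zs`. [cite: HatcherAT2002, §3.1 p. 201] -/
theorem map_fstPiece_map_secPiece (hZs : Zs ⊆ Y₁ ∩ Y₂) {z : Y} (hz : z ∈ Zs) (n : ℕ)
    (a : singularCohomology R M ↥(interPiece U Y₁ Y₂ Zs) n) :
    singularCohomology.map R M (fstPiece U Y₁ Y₂ Zs) n (singularCohomology.map R M (secPiece U hZs hz) n a) = a := by
  obtain ⟨b, rfl⟩ := (map_fstPiece_bijective R M (U := U) hZs n).2 a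
  rw [← ModuleCat.comp_apply (singularCohomology.map R M (fstPiece U Y₁ Y₂ Zs) n), ← singularCohomology.map_comp,
    fstPiece_comp_secPiece, singularCohomology.map_id, ModuleCat.id_apply]

omit [ContractibleSpace ↥Zs] in
/-- Restricting a class pulled back from `U` to the piece `U × Zs`. [folklore] -/
theorem map_subsetIncl_interPiece_map_fstInter (n : ℕ) (c : singularCohomology R M U n) :
    singularCohomology.map R M (subsetIncl (interPiece U Y₁ Y₂ Zs)) n
        (singularCohomology.map R M (fstInter U Y₁ Y₂) n c) =
      singularCohomology.map R M (fstPiece U Y₁ Y₂ Zs) n c := by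
  rw [← ModuleCat.comp_apply, ← singularCohomology.map_comp]
  rfl

end Piece

namespace IsCircleLike

variable {Y₁ Y₂ Zp Zm : Set Y} (hY : IsCircleLike Y Y₁ Y₂ Zp Zm)
include hY

/-- `Z₊ ⊆ Y₁ ∩ Y₂`. [folklore] -/
theorem plus_subset : Zp ⊆ Y₁ ∩ Y₂ := fun _ hz => hY.plus_union_minus ▸ Or.inl hz

/-- `Z₋ ⊆ Y₁ ∩ Y₂`. [folklore] -/
theorem minus_subset : Zm ⊆ Y₁ ∩ Y₂ := fun _ hz => hY.plus_union_minus ▸ Or.inr hz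

/-- `Z₊ ≠ ∅`. [folklore] -/
theorem nonempty_plus : Zp.Nonempty := by
  haveI := hY.contractible_plus
  obtain ⟨⟨z, hz⟩⟩ := (inferInstance : Nonempty ↥Zp)
  exact ⟨z, hz⟩

/-- `Z₋ ≠ ∅`. [folklore] -/
theorem nonempty_minus : Zm.Nonempty := by
  haveI := hY.contractible_minus
  obtain ⟨⟨z, hz⟩⟩ := (inferInstance : Nonempty ↥Zm)
  exact ⟨z, hz⟩

/-- `Y₁ ≠ ∅`. [folklore] -/
theorem nonempty_left : Y₁.Nonempty :=
  let ⟨z, hz⟩ := hY.nonempty_plus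
  ⟨z, (hY.plus_subset hz).1⟩

omit hY in
variable (U Y₁ Y₂ Zp Zm) in
/-- The two pieces `U × Z₊` (`true`) and `U × Z₋` (`false`) of `U × (Y₁ ∩ Y₂)`. [folklore] -/
def pieces : Bool → Set ↥(inter U Y₁ Y₂) := fun b => interPiece U Y₁ Y₂ (bif b then Zp else Zm)

/-- **The pieces form a clopen partition of `U × (Y₁ ∩ Y₂)`.** [folklore] -/
theorem isClopenPartition_pieces : IsClopenPartition (pieces U Y₁ Y₂ Zp Zm) where
  isOpen b := by
    cases b
    · exact isOpen_interPiece hY.isOpen_minus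
    · exact isOpen_interPiece hY.isOpen_plus
  disjoint j k hjk := by
    cases j <;> cases k
    · exact absurd rfl hjk
    · exact Set.disjoint_left.2 fun p (hp : p.1.1.2 ∈ Zm) (hq : p.1.1.2 ∈ Zp) =>
        Set.disjoint_left.1 hY.disjoint hq hp
    · exact Set.disjoint_left.2 fun p (hp : p.1.1.2 ∈ Zp) (hq : p.1.1.2 ∈ Zm) =>
        Set.disjoint_left.1 hY.disjoint hp hq
    · exact absurd rfl hjk
  exists_mem p := by
    have hp : p.1.1.2 ∈ Zp ∪ Zm := by
      rw [hY.plus_union_minus]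
      exact ⟨p.2, p.1.2⟩
    rcases hp with hp | hp
    · exact ⟨true, hp⟩
    · exact ⟨false, hp⟩

/-- Two classes of `U × (Y₁ ∩ Y₂)` with the same restrictions to `U × Z₊` and to `U × Z₋` are equal.
[cite: HatcherAT2002, §3.1 p. 202] -/
theorem eq_of_map_pieces_eq {n : ℕ} {a b : singularCohomology R M ↥(inter U Y₁ Y₂) n}
    (hp : singularCohomology.map R M (subsetIncl (interPiece U Y₁ Y₂ Zp)) n a =
      singularCohomology.map R M (subsetIncl (interPiece U Y₁ Y₂ Zp)) n b)
    (hm : singularCohomology.map R M (subsetIncl (interPiece U Y₁ Y₂ Zm)) n a =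
      singularCohomology.map R M (subsetIncl (interPiece U Y₁ Y₂ Zm)) n b) : a = b := by
  rw [← sub_eq_zero]
  refine singularCohomology.eq_zero_of_forall_map_subsetIncl_eq_zero (hY.isClopenPartition_pieces (U := U)) fun j => ?_
  cases j
  · change singularCohomology.map R M (subsetIncl (interPiece U Y₁ Y₂ Zm)) n (a - b) = 0
    rw [map_sub, hm, sub_self]
  · change singularCohomology.map R M (subsetIncl (interPiece U Y₁ Y₂ Zp)) n (a - b) = 0
    rw [map_sub, hp, sub_self]

/-! ### The extension `ext₊ : Hʲ(U) → Hʲ(U × (Y₁ ∩ Y₂))` (pull back to `U × Z₊`, zero on `U × Z₋`) -/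

omit hY in
variable (U Y₁ Y₂ Zp Zm) in
/-- The family (`pr^* c` on `U × Z₊`, `0` on `U × Z₋`). [folklore] -/
def plusFamily (j : ℕ) :
    singularCohomology R M U j →ₗ[R] ((b : Bool) → singularCohomology R M ↥(pieces U Y₁ Y₂ Zp Zm b) j) :=
  LinearMap.pi fun b => match b with
    | true => (singularCohomology.map R M (fstPiece U Y₁ Y₂ Zp) j).hom
    | false => 0

/-- **`ext₊ c`**: the class of `U × (Y₁ ∩ Y₂)` restricting to `pr^* c` on `U × Z₊` and to `0` on
`U × Z₋` (additivity of cohomology over the clopen partition). [cite: HatcherAT2002, §3.1 p. 202] -/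
def extPlus (j : ℕ) : singularCohomology R M U j →ₗ[R] singularCohomology R M ↥(inter U Y₁ Y₂) j :=
  (singularCohomology.piRestrictEquiv (hY.isClopenPartition_pieces (U := U)) j).symm.toLinearMap ∘ₗ
    plusFamily U R M Y₁ Y₂ Zp Zm j

/-- `ext₊ c` restricted to `U × Z₊` is `pr^* c`. [cite: HatcherAT2002, §3.1 p. 202] -/
theorem map_plus_extPlus (j : ℕ) (c : singularCohomology R M U j) :
    singularCohomology.map R M (subsetIncl (interPiece U Y₁ Y₂ Zp)) j ((hY.extPlus R M j) c) =
      singularCohomology.map R M (fstPiece U Y₁ Y₂ Zp) j c := by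
  exact congrFun ((singularCohomology.piRestrictEquiv
    (hY.isClopenPartition_pieces (U := U)) j).apply_symm_apply (plusFamily U R M Y₁ Y₂ Zp Zm j c)) true

/-- `ext₊ c` restricted to `U × Z₋` is `0`. [cite: HatcherAT2002, §3.1 p. 202] -/
theorem map_minus_extPlus (j : ℕ) (c : singularCohomology R M U j) :
    singularCohomology.map R M (subsetIncl (interPiece U Y₁ Y₂ Zm)) j ((hY.extPlus R M j) c) = 0 := by
  exact congrFun ((singularCohomology.piRestrictEquiv
    (hY.isClopenPartition_pieces (U := U)) j).apply_symm_apply (plusFamily U R M Y₁ Y₂ Zp Zm j c)) false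

/-- `ext₊ c = 0 ↔ c = 0`. [folklore] -/
theorem extPlus_eq_zero_iff (j : ℕ) (c : singularCohomology R M U j) : (hY.extPlus R M j) c = 0 ↔ c = 0 := by
  haveI := hY.contractible_plus
  refine ⟨fun h => ?_, fun h => by rw [h, map_zero]⟩
  have := hY.map_plus_extPlus R M j c
  rw [h, map_zero] at this
  exact (map_fstPiece_bijective R M (U := U) hY.plus_subset j).1 (by rw [← this, map_zero])

/-- **`ext₊ c` is pulled back from `U` only if `c = 0`** (`pr^* e` restricts to `pr^* e` on BOTH
pieces). [folklore] -/
theorem extPlus_mem_range_iff (j : ℕ) (c : singularCohomology R M U j) :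
    (hY.extPlus R M j) c ∈ LinearMap.range (singularCohomology.map R M (fstInter U Y₁ Y₂) j).hom ↔ c = 0 := by
  haveI := hY.contractible_plus
  haveI := hY.contractible_minus
  refine ⟨fun ⟨e, he⟩ => ?_, fun h => ⟨0, by rw [h, map_zero, map_zero]⟩⟩
  have hm := hY.map_minus_extPlus R M j c
  rw [← he] at hm
  change singularCohomology.map R M (subsetIncl (interPiece U Y₁ Y₂ Zm)) j
    (singularCohomology.map R M (fstInter U Y₁ Y₂) j e) = 0 at hm
  rw [map_subsetIncl_interPiece_map_fstInter] at hm
  have he0 : e = 0 := (map_fstPiece_bijective R M (U := U) hY.minus_subset j).1 (by rw [hm, map_zero])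
  rw [he0, map_zero] at he
  exact (hY.extPlus_eq_zero_iff R M j c).1 he.symm

/-- **Every class of `U × (Y₁ ∩ Y₂)` is `pr^* c₋ + ext₊(c₊ - c₋)`** with `c± = s±^*` of its
restrictions to the pieces. [cite: HatcherAT2002, §3.1 pp. 201–202] -/
theorem eq_map_fstInter_add_extPlus {zp zm : Y} (hzp : zp ∈ Zp) (hzm : zm ∈ Zm) (j : ℕ)
    (a : singularCohomology R M ↥(inter U Y₁ Y₂) j) :
    a = singularCohomology.map R M (fstInter U Y₁ Y₂) j
          (singularCohomology.map R M (secPiece U hY.minus_subset hzm) j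
            (singularCohomology.map R M (subsetIncl (interPiece U Y₁ Y₂ Zm)) j a)) +
        (hY.extPlus R M j)
          (singularCohomology.map R M (secPiece U hY.plus_subset hzp) j
              (singularCohomology.map R M (subsetIncl (interPiece U Y₁ Y₂ Zp)) j a) -
            singularCohomology.map R M (secPiece U hY.minus_subset hzm) j
              (singularCohomology.map R M (subsetIncl (interPiece U Y₁ Y₂ Zm)) j a)) := by
  haveI := hY.contractible_plus
  haveI := hY.contractible_minus
  refine hY.eq_of_map_pieces_eq R M ?_ ?_
  · rw [map_add, map_subsetIncl_interPiece_map_fstInter, hY.map_plus_extPlus R M, map_sub, add_sub_cancel,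
      map_fstPiece_map_secPiece R M hY.plus_subset hzp]
  · rw [map_add, map_subsetIncl_interPiece_map_fstInter, hY.map_minus_extPlus R M, add_zero,
      map_fstPiece_map_secPiece R M hY.minus_subset hzm]

/-! ### The decomposition of `Hⁱ⁺¹(U × Y)` -/

/-- **`circleMap (y, c) = pr₁^* y + κ(ext₊ c) : Hⁱ⁺¹(U) × Hⁱ(U) → Hⁱ⁺¹(U × Y)`.**
[cite: HatcherAT2002, §3.1 pp. 200–202] -/
def circleMap (i : ℕ) :
    (singularCohomology R M U (i + 1) × singularCohomology R M U i) →ₗ[R] singularCohomology R M (U × Y) (i + 1) :=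
  (singularCohomology.map R M (ContinuousMap.fst : C(U × Y, U)) (i + 1)).hom.coprod
    ((twoPieceKappa R M hY.isOpen_left hY.isOpen_right hY.union_eq i).hom ∘ₗ hY.extPlus R M i)

/-- `circleMap (y, c) = pr₁^* y + κ(ext₊ c)`. [folklore] -/
theorem circleMap_apply (i : ℕ) (y : singularCohomology R M U (i + 1)) (c : singularCohomology R M U i) :
    (hY.circleMap R M i) (y, c) = singularCohomology.map R M (ContinuousMap.fst : C(U × Y, U)) (i + 1) y +
      twoPieceKappa R M hY.isOpen_left hY.isOpen_right hY.union_eq i ((hY.extPlus R M i) c) :=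
  rfl

/-- **`s^* ∘ circleMap = pr₁`** for every slice `s` through a point of `Y₁`. [cite: HatcherAT2002, §3.1 p. 200] -/
theorem map_sliceAt_circleMap {y₁ : Y} (hy₁ : y₁ ∈ Y₁) (i : ℕ) (y : singularCohomology R M U (i + 1))
    (c : singularCohomology R M U i) :
    singularCohomology.map R M (sliceAt (U := U) y₁) (i + 1) ((hY.circleMap R M i) (y, c)) = y := by
  rw [hY.circleMap_apply R M, map_add, map_sliceAt_map_fst, map_sliceAt_twoPieceKappa R M _ _ _ hy₁, add_zero]

/-- `circleMap (y, c) = circleMap (y', c')` forces `y = y'` and `c = c'`. [cite: HatcherAT2002, §3.1 pp. 200–202] -/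
theorem circleMap_injective (i : ℕ) : Function.Injective (hY.circleMap R M (U := U) i) := by
  haveI := hY.contractible_left
  haveI := hY.contractible_right
  rintro ⟨y, c⟩ ⟨y', c'⟩ h
  rw [hY.circleMap_apply R M, hY.circleMap_apply R M] at h
  obtain ⟨rfl, hκ⟩ := eq_of_map_fst_add_twoPieceKappa_eq R M hY.isOpen_left hY.isOpen_right hY.union_eq i h
  have h0 : twoPieceKappa R M hY.isOpen_left hY.isOpen_right hY.union_eq i ((hY.extPlus R M i) (c - c')) = 0 := by
    rw [map_sub, map_sub, hκ, sub_self]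
  rw [twoPieceKappa_eq_zero_iff, hY.extPlus_mem_range_iff R M, sub_eq_zero] at h0
  rw [h0]

/-- **`circleMap` is surjective**: `x = pr₁^*(s^* x) + κ a` and `a = pr^* c₋ + ext₊(c₊ - c₋)` with
`κ(pr^* c₋) = 0`. [cite: HatcherAT2002, §3.1 pp. 200–202] -/
theorem circleMap_surjective (i : ℕ) : Function.Surjective (hY.circleMap R M (U := U) i) := by
  haveI := hY.contractible_left
  haveI := hY.contractible_right
  obtain ⟨zp, hzp⟩ := hY.nonempty_plus
  obtain ⟨zm, hzm⟩ := hY.nonempty_minus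
  intro x
  obtain ⟨a, ha⟩ := exists_eq_map_fst_add_twoPieceKappa R M hY.isOpen_left hY.isOpen_right hY.union_eq
    (hY.plus_subset hzp) (hY.plus_subset hzp).1 i x
  rw [hY.eq_map_fstInter_add_extPlus R M hzp hzm i a, map_add,
    (twoPieceKappa_eq_zero_iff R M _ _ _ i _).2 ⟨_, rfl⟩, zero_add] at ha
  exact ⟨(_, _), ha.symm⟩

/-- **`Hⁱ⁺¹(U) × Hⁱ(U) ≅ Hⁱ⁺¹(U × Y)` for circle-like `Y`.** [cite: HatcherAT2002, §3.1 pp. 200–202] -/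
theorem circleMap_bijective (i : ℕ) : Function.Bijective (hY.circleMap R M (U := U) i) :=
  ⟨hY.circleMap_injective R M i, hY.circleMap_surjective R M i⟩

/-- `Hⁱ⁺¹(U) × Hⁱ(U) ≃ₗ Hⁱ⁺¹(U × Y)` for circle-like `Y`. [cite: HatcherAT2002, §3.1 pp. 200–202] -/
def circleEquiv (i : ℕ) :
    (singularCohomology R M U (i + 1) × singularCohomology R M U i) ≃ₗ[R] singularCohomology R M (U × Y) (i + 1) :=
  LinearEquiv.ofBijective (hY.circleMap R M i) (hY.circleMap_bijective R M i)

/-- The equivalence is `circleMap`. [folklore] -/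
@[simp]
theorem circleEquiv_apply (i : ℕ) (p : singularCohomology R M U (i + 1) × singularCohomology R M U i) :
    (hY.circleEquiv R M i) p = (hY.circleMap R M i) p := rfl

/-- **A class of `U × Y` is pulled back from `U` iff its second coordinate vanishes.**
[cite: HatcherAT2002, §3.1 pp. 200–202] -/
theorem circleMap_mem_range_iff (i : ℕ) (y : singularCohomology R M U (i + 1)) (c : singularCohomology R M U i) :
    (hY.circleMap R M i) (y, c) ∈
        LinearMap.range (singularCohomology.map R M (ContinuousMap.fst : C(U × Y, U)) (i + 1)).hom ↔ c = 0 := by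
  refine ⟨fun ⟨y', hy'⟩ => ?_, fun h => ⟨y, by rw [h, hY.circleMap_apply R M, map_zero, map_zero, add_zero]⟩⟩
  have : (hY.circleMap R M i) (y', 0) = (hY.circleMap R M i) (y, c) := by
    rw [← hy', hY.circleMap_apply R M, map_zero, map_zero, add_zero]
  exact ((Prod.ext_iff.1 (hY.circleMap_injective R M i this)).2).symm

/-- **`pr₁^* : H⁰(U) ≅ H⁰(U × Y)` for circle-like `Y`.** [cite: HatcherAT2002, §3.1 pp. 200–201] -/
theorem map_fst_bijective_zero : Function.Bijective (singularCohomology.map R M (ContinuousMap.fst : C(U × Y, U)) 0) := by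
  haveI := hY.contractible_left
  haveI := hY.contractible_right
  obtain ⟨zp, hzp⟩ := hY.nonempty_plus
  exact SingularHomology.map_fst_bijective_zero R M hY.isOpen_left hY.isOpen_right hY.union_eq (hY.plus_subset hzp)

/-! ### Naturality in `U` -/

omit hY in
/-- `(g × 𝟙)|` maps the piece `U' × Zs` into `U × Zs`. [folklore] -/
theorem mapsTo_prodMapIdInter_interPiece (g : C(U', U)) (Zs : Set Y) :
    MapsTo (prodMapIdInter g Y₁ Y₂) (interPiece U' Y₁ Y₂ Zs) (interPiece U Y₁ Y₂ Zs) := fun _ hp => hp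

omit hY in
/-- Restriction to a piece commutes with `(g × 𝟙)|`. [folklore] -/
theorem map_subsetIncl_interPiece_map_prodMapIdInter (g : C(U', U)) (Zs : Set Y) (j : ℕ)
    (a : singularCohomology R M ↥(inter U Y₁ Y₂) j) :
    singularCohomology.map R M (subsetIncl (interPiece U' Y₁ Y₂ Zs)) j
        (singularCohomology.map R M (prodMapIdInter g Y₁ Y₂) j a) =
      singularCohomology.map R M (relSingularCohomology.restrictPair (prodMapIdInter g Y₁ Y₂)
          (mapsTo_prodMapIdInter_interPiece g Zs)) j
        (singularCohomology.map R M (subsetIncl (interPiece U Y₁ Y₂ Zs)) j a) := by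
  rw [← ModuleCat.comp_apply, ← ModuleCat.comp_apply, ← singularCohomology.map_comp, ← singularCohomology.map_comp]
  rfl

/-- **`ext₊` is natural in `U`.** [folklore] -/
theorem map_prodMapIdInter_extPlus (g : C(U', U)) (j : ℕ) (c : singularCohomology R M U j) :
    singularCohomology.map R M (prodMapIdInter g Y₁ Y₂) j ((hY.extPlus R M (U := U) j) c) =
      (hY.extPlus R M (U := U') j) (singularCohomology.map R M g j c) := by
  refine hY.eq_of_map_pieces_eq R M ?_ ?_
  · rw [hY.map_plus_extPlus R M, map_subsetIncl_interPiece_map_prodMapIdInter R M g Zp, hY.map_plus_extPlus R M,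
      ← ModuleCat.comp_apply, ← ModuleCat.comp_apply, ← singularCohomology.map_comp, ← singularCohomology.map_comp]
    rfl
  · rw [hY.map_minus_extPlus R M, map_subsetIncl_interPiece_map_prodMapIdInter R M g Zm, hY.map_minus_extPlus R M,
      map_zero]

/-- **`circleMap` is natural in `U`**: `(g × 𝟙)^* circleMap_U (y, c) = circleMap_{U'} (g^* y, g^* c)`.
[cite: HatcherAT2002, §3.1 p. 200] -/
theorem map_prodMapId_circleMap (g : C(U', U)) (i : ℕ) (y : singularCohomology R M U (i + 1))
    (c : singularCohomology R M U i) :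
    singularCohomology.map R M (prodMapId g) (i + 1) ((hY.circleMap R M (U := U) i) (y, c)) =
      (hY.circleMap R M (U := U') i) (singularCohomology.map R M g (i + 1) y, singularCohomology.map R M g i c) := by
  rw [circleMap_apply, circleMap_apply, map_add, map_prodMapId_twoPieceKappa, hY.map_prodMapIdInter_extPlus R M,
    ← ModuleCat.comp_apply, ← ModuleCat.comp_apply, ← singularCohomology.map_comp, ← singularCohomology.map_comp]
  rfl

end IsCircleLike

end Literature.AlgebraicTopology.SingularHomology
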